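import Summits.ResolutionOfSingularities.ResolutionOfSingularities.Theorems.FrobeniusLadderFInjectiveMacaulayficationLocalFullificationFibreClosedGe4Split
import Summits.ResolutionOfSingularities.ResolutionOfSingularities.Theorems.FrobeniusLadderFInjectiveMacaulayficationLocalFullificationFibreGe4Split
import Summits.ResolutionOfSingularities.ResolutionOfSingularities.Theorems.FrobeniusLadderFInjectiveMacaulayficationFTemkinClosedPoints
import Literature.AlgebraicGeometry.Resolution.CofinalityFromPrincipalization
import Literature.AlgebraicGeometry.Resolution.SigmaMaxEliminationInDim
import Literature.AlgebraicGeometry.Resolution.ExcellentRingsFieldProofs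
import Literature.AlgebraicGeometry.Resolution.ExcellentBlowup
import Literature.AlgebraicGeometry.CossartJannsenSaito2020.BlowupTowerLocalizeTransfer
import HarnessLib

/-!
# (CZ2) THE CM-HALF OF THE LOCAL DOOR FROM ČESNAVIČIUS'S BLOW-UP MACAULAYFICATION: (LF_cl-CM), (LF-CM), (L4♭-CM) ⟸ [Česnavičius 2021, Thm. 5.3]
# (crux `FInjectiveMacaulayfication` stmt-ResolutionOfSingularities-15315, chain w45a; res-L1-w45a-plan-1 RULING R17.7 (4) programme «CZ», object (CZ2);
# seat res-L1-w45a-stub-2 g6)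

[OURS · L1 W4.5a] Support file (`--supports stmt-ResolutionOfSingularities-15315 --as helper`); replaces the role of NO printed item; NOT a statement of
the manuscript; def-free; THEOREMS modulo ONE printed result taken as the HYPOTHESIS `hM`, spelled out token for token as the candidate Literature
text `CesnaviciusBlowupMacaulayfication` of this seat's FACT-REQUEST (HOME `L/res-L1-w45a-stub-2/FACT-REQUEST-Cesnavicius.md`, sha16 of the Lean text
bf2f9b4cfcfbf1d7 — so that `(hM : CesnaviciusBlowupMacaulayfication.{0})` will apply by unfolding once the desk admits the fact; until then `hM` is just a
`Prop`-binder of OURS and every theorem here is CONDITIONAL on it): *[Česnavičius 2021, Thm. 5.3, special case] every integral Noetherian EXCELLENT scheme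
`X` has an ideal sheaf `Z`, no point of whose support has a Cohen–Macaulay stalk, such that every blowing up of `X` along `Z` has Cohen–Macaulay stalks.*
AI-written (AI review is weaker than expert review).

THE REDUCTION `exists_cmCentre_of_fact`. For `X/k` an integral variety, `x ∈ X`, and a blowing up `g : S′ → Spec 𝒪_{X,x}` along `I ≠ ⊥` that is
REGULAR off its closed fibre: `S′` is integral (`IsBlowup.isIntegral`), Noetherian (proper over the Noetherian `Spec 𝒪_{X,x}`) and EXCELLENT — `X` is
excellent (finite type over a field: `isExcellentRing_of_field`, `Scheme.isExcellent_Spec_of_isExcellentRing`, `Scheme.IsExcellent.of_locallyOfFiniteType`),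
so is `𝒪_{X,x}` (`isExcellentRing_stalk_of_isExcellent`), hence `Spec 𝒪_{X,x}` and its blowing up `S′` (`IsBlowup.isExcellent`). The fact gives `Z`;
`Z ≠ ⊥` because the generic point of `S′` is regular, hence Cohen–Macaulay, hence not in `supp Z`; `supp Z` lies in the non-CM locus ⊆ the non-regular
locus ⊆ the closed fibre (`hreg`); every blowing up along `Z` is integral (domain stalks) with Cohen–Macaulay stalks. That is EXACTLY the conclusion of the
CM-halves, at every level at once (no dimension, no closedness used):
* `localMacaulayficationFibreClosedGe4_of_fact (hM) : LocalFullificationFibreClosedGe4Split.LocalMacaulayficationFibreClosedGe4` — (LF_cl-CM), the CM-half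
  of the REGISTERED stub of v36.1;
* `localMacaulayficationFibreGe4_of_fact (hM) : LocalFullificationFibreGe4Split.LocalMacaulayficationFibreGe4` — (LF-CM) (res-L1-w45a-stub-1's N1 def);
* `localMacaulayficationDimFourFibre_of_fact (hM) : LocalFullificationDimFourFibreSplit.LocalMacaulayficationDimFourFibre` — (L4♭-CM), d = 4.
CONSEQUENCE (door v37, on admission of the fact): with `localFullificationFibreClosedGe4_of_split`, **(LF_cl) ⟸ [Česnavičius 5.3] ∧ (LF_cl-F)** —
`localFullificationFibreClosedGe4_of_fact_of_F (hM) (hF : LocalFInjectivizationFibreClosedGe4)`; the registered F-side residue becomes the F-half alone.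
[folklore assembly; cite: Cesnavicius2021, Thm. 5.3 and Ex. 1.3] [cite: Matsumura1987, §32 p. 260 (excellence: fields, finite type, localisation)]
[cite: Matsumura1987, Thm. 17.8 (regular ⇒ Cohen–Macaulay, via the tree's `fullCl_of_isRegularLocalRing`)]
-/

-- single-problem summit: the doubled namespace component is forced
set_option linter.dupNamespace false

noncomputable section

namespace Summit.ResolutionOfSingularities.ResolutionOfSingularities.Theorems.FInjectiveMacaulayfication.LocalMacaulayficationOfFact

open CategoryTheory CategoryTheory.Limits AlgebraicGeometry TopologicalSpace IsLocalRing
open Literature.AlgebraicGeometry.Resolution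
open Summit.ResolutionOfSingularities.ResolutionOfSingularities.Theorems.FInjectiveMacaulayfication
open SliceableCentre

/-! ## §1 Excellence of the local blow-up scheme -/

/-- A scheme locally of finite type over a field is excellent. [cite: Matsumura1987, §32 p. 260] -/
theorem isExcellent_of_locallyOfFiniteType_field {k : Type} [Field k] {X : Scheme.{0}} (f : X ⟶ Spec (.of k))
    [LocallyOfFiniteType f] : Scheme.IsExcellent X := by
  haveI : IsLocallyNoetherian X := LocallyOfFiniteType.isLocallyNoetherian f
  exact Scheme.IsExcellent.of_locallyOfFiniteType f (Scheme.isExcellent_Spec_of_isExcellentRing k (isExcellentRing_of_field k))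

/-- The local scheme `Spec 𝒪_{X,x}` of a scheme locally of finite type over a field is excellent. [cite: Matsumura1987, §32 p. 260] -/
theorem isExcellent_Spec_stalk_of_field {k : Type} [Field k] {X : Scheme.{0}} (f : X ⟶ Spec (.of k))
    [LocallyOfFiniteType f] (x : X) : Scheme.IsExcellent (Spec (X.presheaf.stalk x)) :=
  Scheme.isExcellent_Spec_of_isExcellentRing _
    (Literature.AlgebraicGeometry.CossartJannsenSaito2020.isExcellentRing_stalk_of_isExcellent (isExcellent_of_locallyOfFiniteType_field f) x)

/-- A regular local ring of characteristic `p` satisfies the CM-clause. [cite: Matsumura1987, Thm. 17.8] -/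
theorem cmCl_of_isRegularLocalRing (p : ℕ) [Fact p.Prime] (O : Type) [CommRing O] [IsRegularLocalRing O] [CharP O p] : CMCl O :=
  RelClosedSubsetFixFinite.cmCl_of_fullCl (FTemkinClosedPoints.fullCl_of_isRegularLocalRing p O)

/-! ## §2 The reduction -/

/-- **The CM-centre from Česnavičius's blow-up Macaulayfication** (see the module docstring): for `g : S′ → Spec 𝒪_{X,x}` a blowing up along `I ≠ ⊥`
regular off its closed fibre, a fibre-supported `𝓚 ≠ ⊥` all of whose blowings up have domain, Cohen–Macaulay stalks — modulo the fact `hM`.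
[OURS · conditional on Cesnavicius2021 Thm. 5.3 as typed] [cite: Cesnavicius2021, Thm. 5.3] -/
theorem exists_cmCentre_of_fact
    (hM : ∀ (Y : Scheme.{0}) [IsIntegral Y] [IsNoetherian Y], Scheme.IsExcellent Y →
      ∃ Z : Y.IdealSheafData,
        (∀ y : Y, y ∈ (Z.support : Set Y) →
          ¬ (∀ d : ℕ, ringKrullDim (Y.presheaf.stalk y) = d →
              ∀ s : Fin d → Y.presheaf.stalk y, (Ideal.span (Set.range s)).radical.IsMaximal →
                RingTheory.Sequence.IsWeaklyRegular (Y.presheaf.stalk y) (List.ofFn s))) ∧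
        ∀ (Y' : Scheme.{0}) (π : Y' ⟶ Y), IsBlowup π Z →
          ∀ y' : Y', ∀ d : ℕ, ringKrullDim (Y'.presheaf.stalk y') = d →
            ∀ s : Fin d → Y'.presheaf.stalk y', (Ideal.span (Set.range s)).radical.IsMaximal →
              RingTheory.Sequence.IsWeaklyRegular (Y'.presheaf.stalk y') (List.ofFn s))
    (p : ℕ) (hp : p.Prime) {k : Type} [Field k] [CharP k p] {X : Scheme.{0}} (f : X ⟶ Spec (.of k))
    [LocallyOfFiniteType f] [IsIntegral X] (x : X)
    (S' : Scheme.{0}) (g : S' ⟶ Spec (X.presheaf.stalk x)) (I : (Spec (X.presheaf.stalk x)).IdealSheafData)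
    (hI : I ≠ ⊥) (hg : IsBlowup g I)
    (hreg : ∀ s : S', g.base s ≠ closedPoint (X.presheaf.stalk x) → s ∈ Scheme.regularLocus S') :
    ∃ 𝓚 : S'.IdealSheafData, 𝓚 ≠ ⊥ ∧ (∀ s ∈ (𝓚.support : Set S'), g.base s = closedPoint (X.presheaf.stalk x)) ∧
      ∀ (S'' : Scheme.{0}) (π : S'' ⟶ S'), IsBlowup π 𝓚 → ∀ s : S'', IsDomain (S''.presheaf.stalk s) ∧ CMCl (S''.presheaf.stalk s) := by
  haveI : Fact p.Prime := ⟨hp⟩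
  haveI : IsLocallyNoetherian X := LocallyOfFiniteType.isLocallyNoetherian f
  haveI : IsIntegral S' := hg.isIntegral hI
  haveI : IsProper g := hg.isProper
  haveI : IsLocallyNoetherian S' := LocallyOfFiniteType.isLocallyNoetherian g
  haveI : CompactSpace S' := QuasiCompact.compactSpace_of_compactSpace g
  haveI : IsNoetherian S' := {}
  have hS'exc : Scheme.IsExcellent S' := hg.isExcellent (isExcellent_Spec_stalk_of_field f x)
  -- regular stalks of `S'` satisfy the CM-clause (characteristic `p` through the structure map to `k`)
  have hregcm : ∀ s : S', s ∈ Scheme.regularLocus S' → CMCl (S'.presheaf.stalk s) := fun s hs => by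
    rw [Scheme.mem_regularLocus] at hs
    haveI := hs
    haveI : CharP (S'.presheaf.stalk s) p := FTemkinClosedPoints.charP_stalk_of_over p f (g ≫ X.fromSpecStalk x) s
    exact cmCl_of_isRegularLocalRing p _
  obtain ⟨Z, hZcm, hZbl⟩ := hM S' hS'exc
  -- `Z ≠ ⊥`: the generic point of `S'` is regular, hence Cohen–Macaulay, hence off `supp Z`
  have hZne : Z ≠ ⊥ := by
    intro h0
    have hgen : genericPoint S' ∈ (Z.support : Set S') := by rw [h0, Scheme.IdealSheafData.support_bot]; trivial
    exact hZcm _ hgen (hregcm _ (genericPoint_mem_regularLocus S'))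
  refine ⟨Z, hZne, fun s hs => ?_, fun S'' π hπ s => ?_⟩
  · -- fibre support: a non-CM point is non-regular, hence lies over the closed point
    by_contra hne
    exact hZcm s hs (hregcm s (hreg s hne))
  · haveI : IsIntegral S'' := hπ.isIntegral hZne
    exact ⟨inferInstance, hZbl S'' π hπ s⟩

/-! ## §3 The CM-halves at every level -/

/-- **(LF_cl-CM) ⟸ [Česnavičius 2021, Thm. 5.3]** — the CM-half of the registered stub of door v36.1. [OURS · conditional on the fact as typed]
[cite: Cesnavicius2021, Thm. 5.3] -/
theorem localMacaulayficationFibreClosedGe4_of_fact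
    (hM : ∀ (Y : Scheme.{0}) [IsIntegral Y] [IsNoetherian Y], Scheme.IsExcellent Y →
      ∃ Z : Y.IdealSheafData,
        (∀ y : Y, y ∈ (Z.support : Set Y) →
          ¬ (∀ d : ℕ, ringKrullDim (Y.presheaf.stalk y) = d →
              ∀ s : Fin d → Y.presheaf.stalk y, (Ideal.span (Set.range s)).radical.IsMaximal →
                RingTheory.Sequence.IsWeaklyRegular (Y.presheaf.stalk y) (List.ofFn s))) ∧
        ∀ (Y' : Scheme.{0}) (π : Y' ⟶ Y), IsBlowup π Z →
          ∀ y' : Y', ∀ d : ℕ, ringKrullDim (Y'.presheaf.stalk y') = d →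
            ∀ s : Fin d → Y'.presheaf.stalk y', (Ideal.span (Set.range s)).radical.IsMaximal →
              RingTheory.Sequence.IsWeaklyRegular (Y'.presheaf.stalk y') (List.ofFn s)) :
    LocalFullificationFibreClosedGe4Split.LocalMacaulayficationFibreClosedGe4 := by
  intro d _ p hp k _ _ X f _ hft _ hint x _ _ S' g I hI hg hreg
  haveI := hft
  exact exists_cmCentre_of_fact hM p hp f x S' g I hI hg hreg

/-- **(LF-CM) ⟸ [Česnavičius 2021, Thm. 5.3]** — the CM-half of (LF) (res-L1-w45a-stub-1's `LocalMacaulayficationFibreGe4`).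
[OURS · conditional on the fact as typed] [cite: Cesnavicius2021, Thm. 5.3] -/
theorem localMacaulayficationFibreGe4_of_fact
    (hM : ∀ (Y : Scheme.{0}) [IsIntegral Y] [IsNoetherian Y], Scheme.IsExcellent Y →
      ∃ Z : Y.IdealSheafData,
        (∀ y : Y, y ∈ (Z.support : Set Y) →
          ¬ (∀ d : ℕ, ringKrullDim (Y.presheaf.stalk y) = d →
              ∀ s : Fin d → Y.presheaf.stalk y, (Ideal.span (Set.range s)).radical.IsMaximal →
                RingTheory.Sequence.IsWeaklyRegular (Y.presheaf.stalk y) (List.ofFn s))) ∧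
        ∀ (Y' : Scheme.{0}) (π : Y' ⟶ Y), IsBlowup π Z →
          ∀ y' : Y', ∀ d : ℕ, ringKrullDim (Y'.presheaf.stalk y') = d →
            ∀ s : Fin d → Y'.presheaf.stalk y', (Ideal.span (Set.range s)).radical.IsMaximal →
              RingTheory.Sequence.IsWeaklyRegular (Y'.presheaf.stalk y') (List.ofFn s)) :
    LocalFullificationFibreGe4Split.LocalMacaulayficationFibreGe4 := by
  intro d _ p hp k _ _ X f _ hft _ hint x _ S' g I hI hg hreg
  haveI := hft
  exact exists_cmCentre_of_fact hM p hp f x S' g I hI hg hreg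

/-- **(L4♭-CM) ⟸ [Česnavičius 2021, Thm. 5.3]** — the CM-half at d = 4 (`LocalMacaulayficationDimFourFibre`, p587643).
[OURS · conditional on the fact as typed] [cite: Cesnavicius2021, Thm. 5.3] -/
theorem localMacaulayficationDimFourFibre_of_fact
    (hM : ∀ (Y : Scheme.{0}) [IsIntegral Y] [IsNoetherian Y], Scheme.IsExcellent Y →
      ∃ Z : Y.IdealSheafData,
        (∀ y : Y, y ∈ (Z.support : Set Y) →
          ¬ (∀ d : ℕ, ringKrullDim (Y.presheaf.stalk y) = d →
              ∀ s : Fin d → Y.presheaf.stalk y, (Ideal.span (Set.range s)).radical.IsMaximal →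
                RingTheory.Sequence.IsWeaklyRegular (Y.presheaf.stalk y) (List.ofFn s))) ∧
        ∀ (Y' : Scheme.{0}) (π : Y' ⟶ Y), IsBlowup π Z →
          ∀ y' : Y', ∀ d : ℕ, ringKrullDim (Y'.presheaf.stalk y') = d →
            ∀ s : Fin d → Y'.presheaf.stalk y', (Ideal.span (Set.range s)).radical.IsMaximal →
              RingTheory.Sequence.IsWeaklyRegular (Y'.presheaf.stalk y') (List.ofFn s)) :
    LocalFullificationDimFourFibreSplit.LocalMacaulayficationDimFourFibre := by
  intro p hp k _ _ X f _ hft _ hint x _ S' g I hI hg hreg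
  haveI := hft
  exact exists_cmCentre_of_fact hM p hp f x S' g I hI hg hreg

/-! ## §4 Door v37's shape: the registered F-side residue is the F-half alone, modulo the fact -/

/-- **(LF_cl) ⟸ [Česnavičius 2021, Thm. 5.3] ∧ (LF_cl-F).** [OURS · conditional on the fact as typed and on the CANDIDATE F-half]
[cite: Cesnavicius2021, Thm. 5.3] -/
theorem localFullificationFibreClosedGe4_of_fact_of_F
    (hM : ∀ (Y : Scheme.{0}) [IsIntegral Y] [IsNoetherian Y], Scheme.IsExcellent Y →
      ∃ Z : Y.IdealSheafData,
        (∀ y : Y, y ∈ (Z.support : Set Y) →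
          ¬ (∀ d : ℕ, ringKrullDim (Y.presheaf.stalk y) = d →
              ∀ s : Fin d → Y.presheaf.stalk y, (Ideal.span (Set.range s)).radical.IsMaximal →
                RingTheory.Sequence.IsWeaklyRegular (Y.presheaf.stalk y) (List.ofFn s))) ∧
        ∀ (Y' : Scheme.{0}) (π : Y' ⟶ Y), IsBlowup π Z →
          ∀ y' : Y', ∀ d : ℕ, ringKrullDim (Y'.presheaf.stalk y') = d →
            ∀ s : Fin d → Y'.presheaf.stalk y', (Ideal.span (Set.range s)).radical.IsMaximal →
              RingTheory.Sequence.IsWeaklyRegular (Y'.presheaf.stalk y') (List.ofFn s))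
    (hF : LocalFullificationFibreClosedGe4Split.LocalFInjectivizationFibreClosedGe4) :
    LocalFullificationFibreClosedGe4.LocalFullificationFibreClosedGe4 :=
  LocalFullificationFibreClosedGe4Split.localFullificationFibreClosedGe4_of_split (localMacaulayficationFibreClosedGe4_of_fact hM) hF

end Summit.ResolutionOfSingularities.ResolutionOfSingularities.Theorems.FInjectiveMacaulayfication.LocalMacaulayficationOfFact

end
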